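import Summits.BirchSwinnertonDyer.Rank1Residual.Additive.GordCycLeadingTermTwist
import Summits.BirchSwinnertonDyer.Rank1Residual.X1.RankOneParitySqueezeLeaf
import HarnessLib

/-!
# The (G)-cell at analytic rank ONE, defect 2: Kato's divisibility + ONE analytic unit certificate
# DISCHARGE the λ-input (`λ ≤ 1` AND `μ = 0`) and the Schneider rider, and make `BSD(E,p)` a single
# `p`-adic valuation (cell `b2b-bsdres`, sub-cell additive-p2, gen 19)

HONEST FRAMING (cell `b2b-bsdres`, run/shared/lean/b2b/bsd-rank1-residual/, verbatim in every
file): the goal of the cell is to DELETE the COMBINATION-SHAPED residual classes of the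
Birch–Swinnerton-Dyer formula for ALL analytic-rank `≤ 1` elliptic curves over `ℚ` — "full BSD
formula for every rank `≤ 1` curve in class `C`" assembled STRICTLY from published theorems — so
that the rank-`≤ 1` remainder becomes exactly the CONSTRUCTION-SHAPED classes, which are TYPED
(missing-input `Prop`s), NOT attempted. This is not "finishing BSD". Sub-cell `additive-p2`
(CLASS-OWNERS row "X3/X4 additive — pot. good ordinary / X3♯(G-ord)"), generation 19: research
route; no claim beyond the stated classes; X3♯(G-ord)/X4♯(G-ord) stay CONSTRUCTION-SHAPED; labels /
census / located gap UNCHANGED; nothing is booked. ONE definition (a CERTIFICATE-SHAPED typed input,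
nothing asserted) and theorems. Named facts enter as HYPOTHESES only (this file and its two sequels):
Delbourgo 2002 (A)+(B) (`Delbourgo2002.mainTheorem`, A175), the component `(p−1)/2` readings of Kato
2004 Thm. 17.4 (3) and of Wuthrich 2014 Thm. 16 (inline-datum forms here; the semistable half-eigenspace
facts `Wuthrich2014.kato_halfEigenCharIdeal_dvd_cyclotomicPrime_of_surjective` /
`Wuthrich2014.thm16_halfEigenCharIdeal_dvd_cyclotomicPrime` at class level), Pal 2012 Thm. 3.2,
Gross–Zagier–Kolyvagin (`hGZK`), modularity (`hmod`, `hmodD`). No `_holds`, no new named fact (debt 0).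

## What and why

Team n1011 (seat p01, `GordCycRankOneLambda.lean`) TYPED the per-pair input `CharLamLeAt W p n` —
"every generator `fE` of `char_Λ X(E/ℚ_∞)` has `λ(fE) ≤ n`" — and PROVED that with `n = rank E(ℚ)`
and Delbourgo's (B)-clauses it discharges the Schneider rider and yields the valuation identity
`ord_p #Ш[p^∞] + ord_p Reg_p + ord_p ∏c + ord_p ℓ = μ(fE) + r + 2·ord_p #tors`; the intended discharge
named there (Delbourgo 2002 Thm. (C) + `λ(L_p^{an}|_Δ)`) is "not a tree object". THIS FILE observes
that on the DEFECT-2 rows the discharge IS in the tree: gen 12's kernel transport [C]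
(`SelmerDualData.exists_chiEigenInCyclotomic`: `X(E/ℚ_∞)` is a `Λ`-dual of
`e_{(p−1)/2}·Sel_{p^∞}(E♭/ℚ(μ_{p^∞}))`, `E♭ = E ⊗ χ_{p*}` good ordinary) feeds the component reading of
Kato's Thm. 17.4 (3) (`ρ̄_{E,p}` onto — X4) resp. Wuthrich's Thm. 16 (`E[p]` reducible — X3), whose
conclusion is a FULL power-series identity `ι g = C(u·ϖ)·B_{(p−1)/2}` for some `g ∈ char_Λ X(E/ℚ_∞)`,
`u ∈ ℤ_p^×`, `B_{(p−1)/2}` the `ω^{(p−1)/2}`-branch of the Mazur–Tate–Teitelbaum series of the newform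
of `E♭` at its unit root and `ϖ` the Néron period ratio (gens 12–13 read this identity at `T = 0`
only). THIS FILE holds §0 (the typed certificate), §1 (the `Λ`-algebra) and §2 (the full-series
bricks); the sequels `GordRankOneKatoCertificateClass.lean` (§3, class level) and
`GordRankOneKatoCertificateBSD.lean` (§4–§6, with Delbourgo 2002 (B)) complete the chain summarised
here. Hence (§1–§2, pure `Λ`-algebra: `μ`, `λ` are additive and see only `g mod (p, T²)`):

* **ONE-NUMBER CERTIFICATE ⟹ `μ(fE) = 0 ∧ λ(fE) ≤ 1`** for EVERY generator `fE` (`fE ∣ g`): the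
  certificate is `BranchUnitCertificateAt W p` (§0, typed, nothing asserted) = "the Néron-normalised
  branch `ϖ·B_{(p−1)/2}` has constant term `0` and linear coefficient a `p`-adic UNIT", i.e.
  `(μ_an, λ_an) = (0, 1)` for the twisted branch — a finite `p`-adic computation per pair (PARI
  `ellpadicL(E♭, p, n, D = p*)`, SAGE `padic_lseries` of `E♭` twisted by `(·/p)`; the census lanes'
  `A′`/`v_p(A′)` column: ttrl2 X4-1/X4-2, instruments I-2/I-4). So `CharLamLeAt W p 1` HOLDS, WITH
  `μ = 0` (§3: `ClassX4Gord.isTorsion_and_mu_zero_lam_le_one_of_katoHalf_of_cert`, X3 twin).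
* With A175 (B) for a height datum `Dh` and Gross–Zagier–Kolyvagin (`rank = 1`, `Ш` finite) (§4):
  **`λ(fE) = 1`, `μ(fE) = 0`, Schneider's `Reg_p(E,Dh) ≠ 0` PROVED (not certified), and the EXACT
  identity `ord_p #Ш(E) + ord_p Reg_p(E,Dh) + ord_p ∏c_ℓ + ord_p ℓ = 1 + 2·ord_p #E(ℚ)_tors`**
  (`ℓ ∣ p²`, `= 1` off the anomalous rows) — for EVERY `Dh` satisfying the clauses, in particular for
  Delbourgo's `⟨,⟩_{p,ℚ}`.
* Hence (§5) on the non-anomalous rows **`BSD(E,p) ⟺ ord_p q + ord_p Reg_p(E,Dh) = 1`** where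
  `L'(E,1) = q·Ω_E·Reg_∞(E)` — `Ш` has DISAPPEARED from the statement: the rank-one residue of
  X4♯(G-ord) ∩ I₀* ∩ {ρ̄ onto} (and of X3♯(G-ord) ∩ I₀*) on the certified rows is EXACTLY the `p`-adic
  Gross–Zagier valuation `ord_p(Reg_p · L'(E,1)/(Ω_E Reg_∞)) = 1` in Delbourgo's normalisation
  (RESIDUAL-MAP §I O7-ord: Disegni 2017 Thm. B ∘ the unwritten comparison); and gen 18's residue
  predicate satisfies `RankOneIwasawaInputAt W p ↔ BSDp W p` there (its height conjuncts are proved).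
* READING FOR THE CENSUS (ttrl2 W2 "X4-2", rmap-2 §D; EVIDENCE, nothing booked): with `h = Reg_p` of
  a generator in Delbourgo's normalisation and `A′ = [T¹](ϖ·B)·log_p(γ)` (`ord_p log_p γ = 1`), the
  identity reads `ord_p(A′) − ord_p(h·#Ш_an·∏c/#tors²) = (ord_p #Ш − ord_p #Ш_an) + ord_p ℓ` on every
  certified row: the fitted `p`-exponent of `R := A′/(h·Ш_an∏c/T²)` IS the `BSD(E,p)` defect (plus the
  `ℓ`-reading on anomalous rows), row by row, given Kato's divisibility — not merely a test of MC (G).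

What is NOT claimed: the certificate (per pair, numerical); anything on defect 3,4,6 (Kato 17.4
needs `p ∤ N(f̃)`); anything at `p = 3` or on the (M)-rows (A175's TODO; the bricks of §2 hold at
every odd `p`); the `ℓ`-reading on anomalous rows; any booking. Labels UNCHANGED.

References: K. Kato, Astérisque 295 (2004) Thm. 17.4 (3) [Kato2004Asterisque]; C. Wuthrich, Doc.
Math. 19 (2014) Thm. 16, §3 [Wuthrich2014]; D. Delbourgo, J. Number Theory 95 (2002) Thm. (A), (B)
[Delbourgo2002]; R. Greenberg, LNM 1716 (1999) §5 [GreenbergLNM1716]; B. Mazur, J. Tate,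
J. Teitelbaum, Invent. Math. 84 (1986) §I.13–I.14 [MazurTateTeitelbaum1986Invent]; L. Washington,
GTM 83 (1997) §7.1 [Washington1997]; W. Stein, C. Wuthrich, Math. Comp. 82 (2013) §4
[SteinWuthrich2013] (certificates of this kind at good ordinary `p`); R. L. Miller, LMS J. Comput.
Math. 14 (2011) Def. 1.1 [Miller2011LMS].
-/

noncomputable section

open scoped Classical MatrixGroups ModularForm NumberField

namespace Summit.BirchSwinnertonDyer.Rank1Residual.Additive

open CongruenceSubgroup WeierstrassCurve NumberField Literature.NumberTheory.EllipticCurves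
  Literature.NumberTheory.EllipticCurves.ModularForms
  Literature.NumberTheory.EllipticCurves.Rank1Residual
  Literature.NumberTheory.GaloisRepresentations Summit.BirchSwinnertonDyer.Rank1Residual.AdditivePotMult
  Summit.BirchSwinnertonDyer.Rank1Residual.X1.MuLambda
  Summit.BirchSwinnertonDyer.Rank1Residual.X1.RankOneParitySqueeze
  IsDedekindDomain

/-! ### §0 The ONE-NUMBER certificate (typed; nothing asserted) -/

/-- **TYPED INPUT (certificate-shaped; nothing asserted): the Néron-normalised `ω^{(p−1)/2}`-branch of
the twist has `(μ_an, λ_an) = (0, 1)`.** For EVERY globally minimal `V` with `C • V^{(p*)} = W`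
(`p* = (−1)^{(p−1)/2} p`; intended: `V = E♭ = E ⊗ χ_{p*}`, good ordinary at `p`), ordinary at `p`,
every newform `f` of `V` and every `ϖ ∈ ℚ` with `ϖ·Ω_V = Ω⁺_f` (`p ≡ 1 (mod 4)`) resp.
`ϖ·|Ω⁻_V| = Ω⁻_f` (`p ≡ 3 (mod 4)`): the power series `ϖ · B_{(p−1)/2}(f, α_p(V))` (MTT branch of the
`p`-adic `L`-series of `f` on the component `(p−1)/2`, `α` the unit root) has constant coefficient `0`
and linear coefficient of `p`-adic norm `1`. A finite `p`-adic computation per pair (the constant term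
vanishes whenever `L(E,1) = 0`, by interpolation — Birch's formula); a predicate on `(W, p)`.
[cite: MazurTateTeitelbaum1986Invent, §I.13–I.14 (the branch series; nothing asserted)]
[cite: SteinWuthrich2013, §4 (shape of such certificates)] -/
def BranchUnitCertificateAt (W : WeierstrassCurve ℚ) (p : ℕ) [Fact p.Prime] : Prop :=
  ∀ (V : WeierstrassCurve ℚ) [V.IsElliptic] [V.IsGloballyMinimal] (C : VariableChange ℚ),
    C • V.quadraticTwist ((-1 : ℚ) ^ (p / 2) * p) = W → IsOrdinaryAt V p →
    ∀ {N : ℕ} [NeZero N] (f : CuspForm (Gamma0 N) 2), IsNewformOf V f →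
    ∀ ϖ : ℚ, (if Even (p / 2) then (ϖ : ℝ) * V.realPeriodRat = plusPeriod f
        else (ϖ : ℝ) * V.imaginaryPeriodRat = minusPeriod f) →
      PowerSeries.constantCoeff (PowerSeries.C (ϖ : ℚ_[p]) *
          (if Even (p / 2) then padicLFunctionBranch f ((unitRoot V p : ℤ_[p]) : ℚ_[p]) (p / 2)
            else padicLFunctionMinusBranch f ((unitRoot V p : ℤ_[p]) : ℚ_[p]) (p / 2))) = 0 ∧
      ‖PowerSeries.coeff 1 (PowerSeries.C (ϖ : ℚ_[p]) *
          (if Even (p / 2) then padicLFunctionBranch f ((unitRoot V p : ℤ_[p]) : ℚ_[p]) (p / 2)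
            else padicLFunctionMinusBranch f ((unitRoot V p : ℤ_[p]) : ℚ_[p]) (p / 2)))‖ = 1

variable (W : WeierstrassCurve ℚ) [W.IsElliptic] (p : ℕ) [hp : Fact p.Prime]

/-! ### §1 `Λ`-algebra: a multiple with `g ≡ unit·T (mod (p, T²))` forces `μ = 0`, `λ ≤ 1` -/

omit [W.IsElliptic] hp in
variable {W p} [Fact p.Prime] in
/-- If `fE ∣ g` in `Λ = ℤ_p⟦T⟧`, `g(0) = 0` and `[T¹] g ∈ ℤ_p^×`, then `μ(fE) = 0` and `λ(fE) ≤ 1`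
(`μ(g) = 0`, `λ(g) = 1` by `mu_eq_zero_and_lam_eq_one_of_isUnit_coeff_one`; `μ`, `λ` are additive on
non-zero elements). [cite: Washington1997, §7.1] -/
theorem mu_eq_zero_and_lam_le_one_of_dvd {fE g : IwasawaAlgebra p} (hdvd : fE ∣ g)
    (h0 : PowerSeries.constantCoeff g = 0) (h1 : IsUnit (PowerSeries.coeff 1 g)) :
    mu fE = 0 ∧ lam fE ≤ 1 := by
  obtain ⟨h, rfl⟩ := hdvd
  obtain ⟨hmu, hlam⟩ := mu_eq_zero_and_lam_eq_one_of_isUnit_coeff_one h0 h1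
  have hg0 : fE * h ≠ 0 := by
    intro h0'
    rw [h0', map_zero] at h1
    exact not_isUnit_zero h1
  have hfE : fE ≠ 0 := left_ne_zero_of_mul hg0
  have hh : h ≠ 0 := right_ne_zero_of_mul hg0
  rw [mu_mul hfE hh] at hmu
  rw [lam_mul hfE hh] at hlam
  omega

omit [W.IsElliptic] hp in
variable {W p} [Fact p.Prime] in
/-- From the full-series identity `ι g = C(u·ϖ)·B` (`u ∈ ℤ_p^×`) and the certificate on `ϖ·B`
(constant term `0`, linear coefficient of norm `1`): `g(0) = 0` and `[T¹] g ∈ ℤ_p^×`. [folklore] -/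
theorem constantCoeff_eq_zero_and_isUnit_coeff_one_of_iota_eq {g : IwasawaAlgebra p} {u : ℤ_[p]ˣ}
    {ϖ : ℚ} {B : PowerSeries ℚ_[p]}
    (hι : iwasawaToPowerSeries p g =
      PowerSeries.C (((u : ℤ_[p]) : ℚ_[p]) * (ϖ : ℚ_[p])) * B)
    (h0 : PowerSeries.constantCoeff (PowerSeries.C (ϖ : ℚ_[p]) * B) = 0)
    (h1 : ‖PowerSeries.coeff 1 (PowerSeries.C (ϖ : ℚ_[p]) * B)‖ = 1) :
    PowerSeries.constantCoeff g = 0 ∧ IsUnit (PowerSeries.coeff 1 g) := by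
  have e0 := constantCoeff_iwasawaToPowerSeries p g
  rw [hι, map_mul, PowerSeries.constantCoeff_C] at e0
  have e1 := Wuthrich2014.coeff_iwasawaToPowerSeries p g 1
  rw [hι, PowerSeries.coeff_C_mul] at e1
  rw [map_mul, PowerSeries.constantCoeff_C] at h0
  rw [PowerSeries.coeff_C_mul] at h1
  have hu : ‖((u : ℤ_[p]) : ℚ_[p])‖ = 1 := by
    rw [← PadicInt.norm_def]
    exact PadicInt.isUnit_iff.mp u.isUnit
  constructor
  · have h : ((PowerSeries.constantCoeff g : ℤ_[p]) : ℚ_[p]) = 0 := by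
      rw [← e0, mul_assoc, h0, mul_zero]
    exact PadicInt.coe_eq_zero.mp h
  · rw [PadicInt.isUnit_iff, PadicInt.norm_def, ← e1, mul_assoc, norm_mul, hu, h1, one_mul]

omit [W.IsElliptic] in
variable {W p} in
/-- **Data-level core.** For a dual datum `D` of `Sel_{p^∞}(E/ℚ_∞)` with generator `fE` of `char_Λ X`,
an element `g ∈ char_Λ X` with `ι g = C(u·ϖ)·B` and the certificate on `ϖ·B`: `μ(fE) = 0` and
`λ(fE) ≤ 1`. [cite: Washington1997, §7.1] -/
theorem mu_eq_zero_and_lam_le_one_of_iota_eq {κ : ZpExtension ℚ p} {γ : Field.absoluteGaloisGroup ℚ}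
    (D : W.SelmerDualData κ γ) {fE g : IwasawaAlgebra p} (hchar : D.charIdeal = Ideal.span {fE})
    (hg : g ∈ D.charIdeal) {u : ℤ_[p]ˣ} {ϖ : ℚ} {B : PowerSeries ℚ_[p]}
    (hι : iwasawaToPowerSeries p g =
      PowerSeries.C (((u : ℤ_[p]) : ℚ_[p]) * (ϖ : ℚ_[p])) * B)
    (h0 : PowerSeries.constantCoeff (PowerSeries.C (ϖ : ℚ_[p]) * B) = 0)
    (h1 : ‖PowerSeries.coeff 1 (PowerSeries.C (ϖ : ℚ_[p]) * B)‖ = 1) :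
    mu fE = 0 ∧ lam fE ≤ 1 := by
  rw [hchar] at hg
  obtain ⟨hg0, hg1⟩ := constantCoeff_eq_zero_and_isUnit_coeff_one_of_iota_eq hι h0 h1
  exact mu_eq_zero_and_lam_le_one_of_dvd (Ideal.mem_span_singleton.mp hg) hg0 hg1

/-! ### §2 The FULL-SERIES bricks: `ι g = C(u·ϖ)·B_{(p−1)/2}` for some `g ∈ char_Λ X(E/ℚ_∞)` -/

/-- **Full-series brick, big image** (gen 12's chain, not truncated at `T = 0`). For `W/ℚ`
potentially good at `p` (`0 ≤ ord_p j(W)`), `p` odd, a globally minimal `V`, good ordinary or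
multiplicative at `p` (the multiplicative case is vacuous), with `C • V^{(p*)} = W`, `ρ_{V,p^∞}` onto,
a cyclotomic `κ/γ` matching the cyclotomic variable, the newform `f` of `V`, the period ratio `ϖ` of
the parity of `(p−1)/2`, and EVERY `Λ`-dual datum `D` of `Sel_{p^∞}(W/ℚ_∞)`: `X(W/ℚ_∞)` is torsion and
SOME `g ∈ char_Λ X(W/ℚ_∞)` has `ι g = C(u·ϖ)·B_{(p−1)/2}(f, α_p(V))`, `u ∈ ℤ_p^×` — from the
component `(p−1)/2` reading of Kato 2004 Thm. 17.4 (3) (`hK`, inline-datum form) via additive-p1's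
[C] and additive-p2's eigen-descent + generator normalisation
(`SelmerDualData.exists_chiEigenInCyclotomic`). [cite: Kato2004Asterisque, Thm. 17.4 (3) (p. 273)]
[cite: GreenbergLNM1716, §5 p. 143] [cite: MazurTateTeitelbaum1986Invent, §I.13–I.14] -/
theorem isTorsion_and_exists_iota_eq_branch_of_katoComponent
    (hK : Kato2004.charIdeal_dvd_padicLFunctionBranch_component_of_surjective)
    (hj : 0 ≤ padicValRat p W.j) (hp2 : p ≠ 2)
    (V : WeierstrassCurve ℚ) [V.IsElliptic] [V.IsGloballyMinimal]
    {κ : ZpExtension ℚ p} {γ : Field.absoluteGaloisGroup ℚ} {N : ℕ} [NeZero N]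
    {f : CuspForm (Gamma0 N) 2}
    (hCW : ∃ C : VariableChange ℚ, C • V.quadraticTwist ((-1 : ℚ) ^ (p / 2) * p) = W)
    (hred : GoodOrd V p ∨ Mult V p) (hsurj : ∀ n : ℕ, V.HasSurjectiveModNGaloisRep (p ^ n : ℕ))
    (hκ : κ.IsCyclotomic) (hγ : κ.IsTopGenerator γ) (hcv : IsCyclotomicVariable p γ)
    (hf : IsNewformOf V f) (D : W.SelmerDualData κ γ) (ϖ : ℚ)
    (hϖ : if Even (p / 2) then (ϖ : ℝ) * V.realPeriodRat = plusPeriod f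
      else (ϖ : ℝ) * V.imaginaryPeriodRat = minusPeriod f) :
    D.IsTorsion ∧ ∃ g ∈ D.charIdeal, ∃ u : ℤ_[p]ˣ,
      iwasawaToPowerSeries p g =
        PowerSeries.C (((u : ℤ_[p]) : ℚ_[p]) * (ϖ : ℚ_[p])) *
          (if Even (p / 2) then padicLFunctionBranch f ((unitRoot V p : ℤ_[p]) : ℚ_[p]) (p / 2)
            else padicLFunctionMinusBranch f ((unitRoot V p : ℤ_[p]) : ℚ_[p]) (p / 2)) := by
  have hpne : ((-1 : ℚ) ^ (p / 2) * p) ≠ 0 := pStar_ne_zero p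
  -- `V` is good ordinary
  have hord : IsOrdinaryAt V p := isOrdinaryAt_of_goodOrd_or_mult_of_model_twist W V hpne hCW hj hred
  obtain ⟨C, hC⟩ := hCW
  -- the fields `F = ℚ(ζ_p) ⊇ K = ℚ(√p*)`
  haveI hcycL : IsCyclotomicExtension {p} ℚ (CyclotomicField p ℚ) := by
    have h : (CyclotomicField.algebra p ℚ : Algebra ℚ (CyclotomicField p ℚ)) =
        DivisionRing.toRatAlgebra := Subsingleton.elim _ _
    exact h ▸ CyclotomicField.isCyclotomicExtension p ℚ
  obtain ⟨K, θ, hK2, hθ, hθ2⟩ := exists_intermediateField_sq_eq_pStar p (CyclotomicField p ℚ) hp2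
  haveI : NumberField K := NumberField.of_module_finite ℚ K
  haveI : IsGalois ℚ K := isGalois_of_finrank_eq_two K hK2
  haveI := normal_galRange K hK2 (sigmaQ_ne_one K hK2 hθ hθ2)
  haveI := normal_galRange_cyclotomic p (CyclotomicField p ℚ)
  haveI : (V.quadraticTwist ((-1 : ℚ) ^ (p / 2) * p)).IsElliptic := V.isElliptic_quadraticTwist hpne
  -- the `Λ`-dual datum of `e_{(p−1)/2} Sel(V/ℚ(μ_{p^∞}))` at a normalised generator, same `char`
  obtain ⟨γ', hγ'KF, hκγ', ⟨g₀, hg₀, hγ'eq⟩, D', hchar, htor⟩ :=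
    SelmerDualData.exists_chiEigenInCyclotomic p (CyclotomicField p ℚ) V K hK2 hθ hθ2 κ hC hp2 D
  -- the fact, applied to that datum (full series)
  obtain ⟨htorX, g, hgmem, u, hιg⟩ := hK p V K (CyclotomicField p ℚ) (κ := κ) (γ := γ') (f := f)
    (chiEigenSelmerIn V K p κ (galRange (K := ℚ) (CyclotomicField p ℚ)))
    (fun t ht ↦ conjH1_mem_chiEigenSelmerIn γ' ht) D'.X D'.toDual hp2 hK2 ⟨θ, hθ2⟩ hord hsurj hκ
    (isTopGenerator_of_kappa_eq κ hκγ' hγ)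
    (isCyclotomicVariable_of_eq_mul p κ hκ hg₀ hγ'eq hcv)
    (Subgroup.mem_inf.mp hγ'KF).1 (Subgroup.mem_inf.mp hγ'KF).2 hf
    (mem_chiEigenSelmerIn_iff_ite V K κ _) D'.bijective D'.toDual_T_smul D'.toDual_C_smul ϖ hϖ
  exact ⟨htor.mp htorX, g, hchar ▸ hgmem, u, hιg⟩

/-- **Full-series brick, reducible** (X3 twin): the same for `W[p]` REDUCIBLE (hence `V[p]`
reducible), from the component `(p−1)/2` reading of Wuthrich 2014 Thm. 16 (`hWu`, inline-datum
form). [cite: Wuthrich2014, Thm. 16 (p. 397)] [cite: GreenbergLNM1716, §5 p. 143]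
[cite: MazurTateTeitelbaum1986Invent, §I.13–I.14] -/
theorem isTorsion_and_exists_iota_eq_branch_of_wuthrichComponent
    (hWu : Wuthrich2014.charIdeal_dvd_padicLFunctionBranch_component)
    (hj : 0 ≤ padicValRat p W.j) (hp2 : p ≠ 2)
    (V : WeierstrassCurve ℚ) [V.IsElliptic] [V.IsGloballyMinimal]
    {κ : ZpExtension ℚ p} {γ : Field.absoluteGaloisGroup ℚ} {N : ℕ} [NeZero N]
    {f : CuspForm (Gamma0 N) 2}
    (hCW : ∃ C : VariableChange ℚ, C • V.quadraticTwist ((-1 : ℚ) ^ (p / 2) * p) = W)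
    (hred : GoodOrd V p ∨ Mult V p) (hredW : ¬ Irr W p)
    (hκ : κ.IsCyclotomic) (hγ : κ.IsTopGenerator γ) (hcv : IsCyclotomicVariable p γ)
    (hf : IsNewformOf V f) (D : W.SelmerDualData κ γ) (ϖ : ℚ)
    (hϖ : if Even (p / 2) then (ϖ : ℝ) * V.realPeriodRat = plusPeriod f
      else (ϖ : ℝ) * V.imaginaryPeriodRat = minusPeriod f) :
    D.IsTorsion ∧ ∃ g ∈ D.charIdeal, ∃ u : ℤ_[p]ˣ,
      iwasawaToPowerSeries p g =
        PowerSeries.C (((u : ℤ_[p]) : ℚ_[p]) * (ϖ : ℚ_[p])) *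
          (if Even (p / 2) then padicLFunctionBranch f ((unitRoot V p : ℤ_[p]) : ℚ_[p]) (p / 2)
            else padicLFunctionMinusBranch f ((unitRoot V p : ℤ_[p]) : ℚ_[p]) (p / 2)) := by
  have hpne : ((-1 : ℚ) ^ (p / 2) * p) ≠ 0 := pStar_ne_zero p
  have hord : IsOrdinaryAt V p := isOrdinaryAt_of_goodOrd_or_mult_of_model_twist W V hpne hCW hj hred
  obtain ⟨C, hC⟩ := hCW
  haveI hcycL : IsCyclotomicExtension {p} ℚ (CyclotomicField p ℚ) := by
    have h : (CyclotomicField.algebra p ℚ : Algebra ℚ (CyclotomicField p ℚ)) =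
        DivisionRing.toRatAlgebra := Subsingleton.elim _ _
    exact h ▸ CyclotomicField.isCyclotomicExtension p ℚ
  obtain ⟨K, θ, hK2, hθ, hθ2⟩ := exists_intermediateField_sq_eq_pStar p (CyclotomicField p ℚ) hp2
  haveI : NumberField K := NumberField.of_module_finite ℚ K
  haveI : IsGalois ℚ K := isGalois_of_finrank_eq_two K hK2
  haveI := normal_galRange K hK2 (sigmaQ_ne_one K hK2 hθ hθ2)
  haveI := normal_galRange_cyclotomic p (CyclotomicField p ℚ)
  haveI : (V.quadraticTwist ((-1 : ℚ) ^ (p / 2) * p)).IsElliptic := V.isElliptic_quadraticTwist hpne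
  obtain ⟨γ', hγ'KF, hκγ', ⟨g₀, hg₀, hγ'eq⟩, D', hchar, htor⟩ :=
    SelmerDualData.exists_chiEigenInCyclotomic p (CyclotomicField p ℚ) V K hK2 hθ hθ2 κ hC hp2 D
  obtain ⟨htorX, g, hgmem, u, hιg⟩ := hWu p V K (CyclotomicField p ℚ) (κ := κ) (γ := γ') (f := f)
    (chiEigenSelmerIn V K p κ (galRange (K := ℚ) (CyclotomicField p ℚ)))
    (fun t ht ↦ conjH1_mem_chiEigenSelmerIn γ' ht) D'.X D'.toDual hp2 hK2 ⟨θ, hθ2⟩ hord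
    (fun hV ↦ hredW ((irr_iff_of_model_twist (W := V) (p := p) hpne ⟨C, hC⟩).mpr hV)) hκ
    (isTopGenerator_of_kappa_eq κ hκγ' hγ)
    (isCyclotomicVariable_of_eq_mul p κ hκ hg₀ hγ'eq hcv)
    (Subgroup.mem_inf.mp hγ'KF).1 (Subgroup.mem_inf.mp hγ'KF).2 hf
    (mem_chiEigenSelmerIn_iff_ite V K κ _) D'.bijective D'.toDual_T_smul D'.toDual_C_smul ϖ hϖ
  exact ⟨htor.mp htorX, g, hchar ▸ hgmem, u, hιg⟩

end Summit.BirchSwinnertonDyer.Rank1Residual.Additive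

end
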